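import Mathlib
import Summits.Ventures.PercRepro2.HCov
import Summits.Ventures.PercRepro2.EdgeCubic
import Summits.Ventures.PercRepro2.A3RootEdge
import Summits.Ventures.PercRepro2.RootEdgeBern
import Summits.Ventures.PercRepro2.PendantA3Pins
import Summits.Ventures.PercRepro2.CPolarA3
import Summits.Ventures.PercRepro2.CPolarA3Marks
import Summits.Ventures.PercRepro2.CPolarSubPlus

/-!
# THE ROAD ON THE QUARTIC, TYPED: (HCOV⁺) along any edge is a quartic with explicit Bernstein
coefficients, its closure principle, its root-edge and `o`-edge faces (blind cell PercRepro2,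
p5 g17; `proofs/P5-OEDGE.md` §21–§23)

`HCovPlus p … := 0 ≤ hcovPlusVal p …`, `hcovPlusVal = Q·Gc + covU·slackB`. Along an edge `e`
(`t = p e`) `Q` is linear, `Gc` the landed cubic (`EdgeLine.Gc_pin_cubic`) and `covU`, `slackB`
quadratics with explicit middle coefficients **`covUm`**, **`slackBm`**; hence
(**`hcovPlusVal_pin_quartic`**) `hcovPlusVal p = (1 − t)⁴·H₀ + t(1 − t)³·H1 + t²(1 − t)²·H2 +
t³(1 − t)·H3 + t⁴·H₄` with `H1 = Q₀·B1 + Q₁·Gc₀ + covU₀·slackBm + covUm·slackB₀`,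
`H2 = Q₀·B2 + Q₁·B1 + covU₀·slackB₁ + covUm·slackBm + covU₁·slackB₀`,
`H3 = Q₀·Gc₁ + Q₁·B2 + covUm·slackB₁ + covU₁·slackBm`, and the closure principle
**`HCovPlus_of_update_zero_of_bern`** («CPOLAR⁺» at `e`). At a ROOT edge `{a₁, a₃}` the open pin
vanishes (**`hcovPlusVal_one_root`**), the quartic factors as `(1 − t)·C(t)`
(**`hcovPlusVal_root_factor`**), `H3 = Q₁·B2 ≥ 0` unconditionally (**`H3_nonneg_root`**) and
`H1`, `H2` are explicit with the cross term `c = Qo₁·D₀ − Q₁·Do₀` (**`H1_eq_root`**,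
**`H2_eq_root`**, **`HCovPlus_of_update_zero_root`**): the root-edge face of the quartic road is
exactly `0 ≤ H1 ∧ 0 ≤ H2` there (census-nonnegative, no theorem). At an `o`-EDGE `{a₃, o}` the
open pin is `Qo·D·slackB ≥ 0` (**`HCovPlus_one_oedge`**, unconditional) — open-pin slack exactly
where the cubic's open pin vanishes.
-/

namespace Summit.Ventures.PercRepro2

open UnionCluster CovForm CovForm.EdgeLine CovForm.CPolarA3 PendantA3 CPolarSubPlus

namespace HCovPlusQuartic

section Defs

variable {V : Type*} {E : Type*} [Fintype E] [DecidableEq E] {R : Type*} [Field R]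
  [LinearOrder R]

/-- `Qo = P(Q, o ∈ U)` (the two one-sided masses of `o`). -/
noncomputable def Qo (p : E → R) (ends : E → Sym2 V) (o a₁ a₂ : V) : R :=
  prob p (avoidAll ends a₂ {a₁} ∩ connEvent ends a₁ o) +
    prob p (avoidAll ends a₂ {a₁} ∩ connEvent ends a₂ o)

/-- `Qb = P(Q, b ∈ U)`. -/
noncomputable def Qb (p : E → R) (ends : E → Sym2 V) (a₁ a₂ b : V) : R :=
  prob p (avoidAll ends a₂ {a₁} ∩ connEvent ends a₁ b) +
    prob p (avoidAll ends a₂ {a₁} ∩ connEvent ends a₂ b)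

/-- The value of the strengthened form: `Q·Gc + covU·slackB` (`HCovPlus` is `0 ≤` it). -/
noncomputable def hcovPlusVal (p : E → R) (ends : E → Sym2 V) (o a₁ a₂ a₃ b : V) : R :=
  prob p (avoidAll ends a₂ {a₁}) * Gc p ends o a₁ a₂ a₃ b +
    covU p ends o a₁ a₂ a₃ * slackB p ends a₁ a₂ a₃ b

/-- `HCovPlus` is `0 ≤ hcovPlusVal`. -/
lemma HCovPlus_iff (p : E → R) (ends : E → Sym2 V) (o a₁ a₂ a₃ b : V) :
    HCovPlus p ends o a₁ a₂ a₃ b ↔ 0 ≤ hcovPlusVal p ends o a₁ a₂ a₃ b := Iff.rfl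

omit [LinearOrder R] in
/-- `covU = Qo·D − Q·Do`. -/
lemma covU_eq (p : E → R) (ends : E → Sym2 V) (o a₁ a₂ a₃ : V) :
    covU p ends o a₁ a₂ a₃ =
      Qo p ends o a₁ a₂ * prob p (PDEvent ends a₁ a₂ a₃) -
        prob p (avoidAll ends a₂ {a₁}) * Do p ends o a₁ a₂ a₃ := rfl

omit [LinearOrder R] in
/-- `slackB = Q·EQb3 + gap·EQ3 + Q·PDb − D·Qb`. -/
lemma slackB_eq (p : E → R) (ends : E → Sym2 V) (a₁ a₂ a₃ b : V) :
    slackB p ends a₁ a₂ a₃ b =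
      prob p (avoidAll ends a₂ {a₁}) * EQb3 p ends a₁ a₂ a₃ b +
        gap p ends a₁ a₂ b * EQ3 p ends a₁ a₂ a₃ +
        prob p (avoidAll ends a₂ {a₁}) * PDb p ends a₁ a₂ a₃ b -
        prob p (PDEvent ends a₁ a₂ a₃) * Qb p ends a₁ a₂ b := rfl

/-- **The middle Bernstein coefficient of the quadratic `covU` along `e`** (the polarisation
`Qo₁·D₀ + Qo₀·D₁ − Q₁·Do₀ − Q₀·Do₁`). -/
noncomputable def covUm (p : E → R) (ends : E → Sym2 V) (o a₁ a₂ a₃ : V) (e : E) : R :=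
  Qo (Function.update p e 1) ends o a₁ a₂ * prob (Function.update p e 0) (PDEvent ends a₁ a₂ a₃) +
    Qo (Function.update p e 0) ends o a₁ a₂ * prob (Function.update p e 1) (PDEvent ends a₁ a₂ a₃) -
    prob (Function.update p e 1) (avoidAll ends a₂ {a₁}) * Do (Function.update p e 0) ends o a₁ a₂ a₃ -
    prob (Function.update p e 0) (avoidAll ends a₂ {a₁}) * Do (Function.update p e 1) ends o a₁ a₂ a₃

/-- **The middle Bernstein coefficient of the quadratic `slackB` along `e`** (its polarisation). -/
noncomputable def slackBm (p : E → R) (ends : E → Sym2 V) (a₁ a₂ a₃ b : V) (e : E) : R :=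
  prob (Function.update p e 1) (avoidAll ends a₂ {a₁}) * EQb3 (Function.update p e 0) ends a₁ a₂ a₃ b +
    prob (Function.update p e 0) (avoidAll ends a₂ {a₁}) * EQb3 (Function.update p e 1) ends a₁ a₂ a₃ b +
    gap (Function.update p e 1) ends a₁ a₂ b * EQ3 (Function.update p e 0) ends a₁ a₂ a₃ +
    gap (Function.update p e 0) ends a₁ a₂ b * EQ3 (Function.update p e 1) ends a₁ a₂ a₃ +
    prob (Function.update p e 1) (avoidAll ends a₂ {a₁}) * PDb (Function.update p e 0) ends a₁ a₂ a₃ b +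
    prob (Function.update p e 0) (avoidAll ends a₂ {a₁}) * PDb (Function.update p e 1) ends a₁ a₂ a₃ b -
    prob (Function.update p e 1) (PDEvent ends a₁ a₂ a₃) * Qb (Function.update p e 0) ends a₁ a₂ b -
    prob (Function.update p e 0) (PDEvent ends a₁ a₂ a₃) * Qb (Function.update p e 1) ends a₁ a₂ b

/-- **`H1`** — the `t(1 − t)³` coefficient of the quartic along `e`. -/
noncomputable def H1 (p : E → R) (ends : E → Sym2 V) (o a₁ a₂ a₃ b : V) (e : E) : R :=
  prob (Function.update p e 0) (avoidAll ends a₂ {a₁}) * B1 p ends o a₁ a₂ a₃ b e +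
    prob (Function.update p e 1) (avoidAll ends a₂ {a₁}) * Gc (Function.update p e 0) ends o a₁ a₂ a₃ b +
    covU (Function.update p e 0) ends o a₁ a₂ a₃ * slackBm p ends a₁ a₂ a₃ b e +
    covUm p ends o a₁ a₂ a₃ e * slackB (Function.update p e 0) ends a₁ a₂ a₃ b

/-- **`H2`** — the `t²(1 − t)²` coefficient. -/
noncomputable def H2 (p : E → R) (ends : E → Sym2 V) (o a₁ a₂ a₃ b : V) (e : E) : R :=
  prob (Function.update p e 0) (avoidAll ends a₂ {a₁}) * B2 p ends o a₁ a₂ a₃ b e +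
    prob (Function.update p e 1) (avoidAll ends a₂ {a₁}) * B1 p ends o a₁ a₂ a₃ b e +
    covU (Function.update p e 0) ends o a₁ a₂ a₃ * slackB (Function.update p e 1) ends a₁ a₂ a₃ b +
    covUm p ends o a₁ a₂ a₃ e * slackBm p ends a₁ a₂ a₃ b e +
    covU (Function.update p e 1) ends o a₁ a₂ a₃ * slackB (Function.update p e 0) ends a₁ a₂ a₃ b

/-- **`H3`** — the `t³(1 − t)` coefficient. -/
noncomputable def H3 (p : E → R) (ends : E → Sym2 V) (o a₁ a₂ a₃ b : V) (e : E) : R :=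
  prob (Function.update p e 0) (avoidAll ends a₂ {a₁}) * Gc (Function.update p e 1) ends o a₁ a₂ a₃ b +
    prob (Function.update p e 1) (avoidAll ends a₂ {a₁}) * B2 p ends o a₁ a₂ a₃ b e +
    covUm p ends o a₁ a₂ a₃ e * slackB (Function.update p e 1) ends a₁ a₂ a₃ b +
    covU (Function.update p e 1) ends o a₁ a₂ a₃ * slackBm p ends a₁ a₂ a₃ b e

end Defs

/-! ## The quadratics and the quartic -/
section Quartic

variable {V : Type*} {E : Type*} [Fintype E] [DecidableEq E] {R : Type*} [Field R]
  [LinearOrder R]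

omit [LinearOrder R] in
/-- Pinning of `Qo`. -/
lemma Qo_pin (p : E → R) (ends : E → Sym2 V) (o a₁ a₂ : V) (e : E) :
    Qo p ends o a₁ a₂ =
      p e * Qo (Function.update p e 1) ends o a₁ a₂ + (1 - p e) * Qo (Function.update p e 0) ends o a₁ a₂ := by
  unfold Qo; rw [prob_eq_pin p _ e, prob_eq_pin p _ e]; ring

omit [LinearOrder R] in
/-- Pinning of `Qb`. -/
lemma Qb_pin (p : E → R) (ends : E → Sym2 V) (a₁ a₂ b : V) (e : E) :
    Qb p ends a₁ a₂ b =
      p e * Qb (Function.update p e 1) ends a₁ a₂ b + (1 - p e) * Qb (Function.update p e 0) ends a₁ a₂ b := by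
  unfold Qb; rw [prob_eq_pin p _ e, prob_eq_pin p _ e]; ring

omit [LinearOrder R] in
/-- **`covU` is a quadratic along `e`** with middle coefficient `covUm`. -/
theorem covU_pin_quadratic (p : E → R) (ends : E → Sym2 V) (o a₁ a₂ a₃ : V) (e : E) :
    covU p ends o a₁ a₂ a₃ =
      (1 - p e) ^ 2 * covU (Function.update p e 0) ends o a₁ a₂ a₃ +
        p e * (1 - p e) * covUm p ends o a₁ a₂ a₃ e +
        (p e) ^ 2 * covU (Function.update p e 1) ends o a₁ a₂ a₃ := by
  rw [covU_eq, covU_eq, covU_eq]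
  unfold covUm
  rw [Qo_pin p ends o a₁ a₂ e, prob_eq_pin p (PDEvent ends a₁ a₂ a₃) e,
    prob_eq_pin p (avoidAll ends a₂ {a₁}) e, Do_pin p ends o a₁ a₂ a₃ e]
  ring

omit [LinearOrder R] in
/-- **`slackB` is a quadratic along `e`** with middle coefficient `slackBm`. -/
theorem slackB_pin_quadratic (p : E → R) (ends : E → Sym2 V) (a₁ a₂ a₃ b : V) (e : E) :
    slackB p ends a₁ a₂ a₃ b =
      (1 - p e) ^ 2 * slackB (Function.update p e 0) ends a₁ a₂ a₃ b +
        p e * (1 - p e) * slackBm p ends a₁ a₂ a₃ b e +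
        (p e) ^ 2 * slackB (Function.update p e 1) ends a₁ a₂ a₃ b := by
  rw [slackB_eq, slackB_eq, slackB_eq]
  unfold slackBm
  rw [Qb_pin p ends a₁ a₂ b e, prob_eq_pin p (PDEvent ends a₁ a₂ a₃) e,
    prob_eq_pin p (avoidAll ends a₂ {a₁}) e, EQb3_pin p ends a₁ a₂ a₃ b e,
    EQ3_pin p ends a₁ a₂ a₃ e, PDb_pin p ends a₁ a₂ a₃ b e, gap_pin p ends a₁ a₂ b e]
  ring

omit [LinearOrder R] in
/-- **The one-edge quartic of (HCOV⁺) in the Bernstein basis** (any edge `e`, `t = p e`). -/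
theorem hcovPlusVal_pin_quartic (p : E → R) (ends : E → Sym2 V) (o a₁ a₂ a₃ b : V) (e : E) :
    hcovPlusVal p ends o a₁ a₂ a₃ b =
      (1 - p e) ^ 4 * hcovPlusVal (Function.update p e 0) ends o a₁ a₂ a₃ b +
        p e * (1 - p e) ^ 3 * H1 p ends o a₁ a₂ a₃ b e +
        (p e) ^ 2 * (1 - p e) ^ 2 * H2 p ends o a₁ a₂ a₃ b e +
        (p e) ^ 3 * (1 - p e) * H3 p ends o a₁ a₂ a₃ b e +
        (p e) ^ 4 * hcovPlusVal (Function.update p e 1) ends o a₁ a₂ a₃ b := by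
  unfold hcovPlusVal H1 H2 H3
  rw [Gc_pin_cubic p ends o a₁ a₂ a₃ b e, covU_pin_quadratic p ends o a₁ a₂ a₃ e,
    slackB_pin_quadratic p ends a₁ a₂ a₃ b e, prob_eq_pin p (avoidAll ends a₂ {a₁}) e]
  ring

end Quartic

/-! ## The closure principle of the quartic road («CPOLAR⁺» at the edge `e`) -/
section Closure

variable {V : Type*} {E : Type*} [Fintype E] [DecidableEq E] {R : Type*} [Field R]
  [LinearOrder R] [IsStrictOrderedRing R]

/-- **Closure of (HCOV⁺) along an edge from its three middle Bernstein coefficients**: (HCOV⁺) at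
`p[e↦0]` and `p[e↦1]` with `0 ≤ H1`, `0 ≤ H2`, `0 ≤ H3` give (HCOV⁺) at `p`. -/
theorem HCovPlus_of_update_zero_of_bern (p : E → R) (hp : IsProbVec p) (ends : E → Sym2 V)
    (o a₁ a₂ a₃ b : V) (e : E) (h₀ : HCovPlus (Function.update p e 0) ends o a₁ a₂ a₃ b)
    (h₁ : HCovPlus (Function.update p e 1) ends o a₁ a₂ a₃ b)
    (hH1 : 0 ≤ H1 p ends o a₁ a₂ a₃ b e) (hH2 : 0 ≤ H2 p ends o a₁ a₂ a₃ b e)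
    (hH3 : 0 ≤ H3 p ends o a₁ a₂ a₃ b e) : HCovPlus p ends o a₁ a₂ a₃ b := by
  rw [HCovPlus_iff] at h₀ h₁ ⊢
  rw [hcovPlusVal_pin_quartic p ends o a₁ a₂ a₃ b e]
  have ht := hp.nonneg e
  have ht' : 0 ≤ 1 - p e := by linarith [hp.le_one e]
  refine add_nonneg (add_nonneg (add_nonneg (add_nonneg ?_ ?_) ?_) ?_) ?_
  · exact mul_nonneg (pow_nonneg ht' 4) h₀
  · exact mul_nonneg (mul_nonneg ht (pow_nonneg ht' 3)) hH1
  · exact mul_nonneg (mul_nonneg (pow_nonneg ht 2) (pow_nonneg ht' 2)) hH2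
  · exact mul_nonneg (mul_nonneg (pow_nonneg ht 3) ht') hH3
  · exact mul_nonneg (pow_nonneg ht 4) h₁

end Closure

/-! ## The root-edge face: the open pin vanishes and the quartic factors -/
section RootEdge

variable {V : Type*} {E : Type*} [Fintype V] [DecidableEq V] [Fintype E] [DecidableEq E]
  {R : Type*} [Field R] [LinearOrder R] [IsStrictOrderedRing R]

variable {ends : E → Sym2 V} {e : E} {a₁ a₃ : V}

omit [Fintype V] [DecidableEq V] [LinearOrder R] [IsStrictOrderedRing R] in
/-- At the open pin of a root edge, `Do = 0`. -/
lemma Do_one_root (p : E → R) (hends : ends e = s(a₁, a₃)) (o a₂ : V) :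
    Do (Function.update p e 1) ends o a₁ a₂ a₃ = 0 := by
  unfold Do
  rw [CovForm.RootEdge.prob_one_PD_inter p hends a₂, CovForm.RootEdge.prob_one_PD_inter p hends a₂]
  ring

omit [Fintype V] [DecidableEq V] [LinearOrder R] [IsStrictOrderedRing R] in
/-- At the open pin of a root edge, `covU = 0` (`Cov(U_o, 1) = 0`). -/
lemma covU_one_root (p : E → R) (hends : ends e = s(a₁, a₃)) (o a₂ : V) :
    covU (Function.update p e 1) ends o a₁ a₂ a₃ = 0 := by
  rw [covU_eq, CovForm.RootEdge.prob_one_PD p hends a₂, Do_one_root p hends o a₂]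
  ring

omit [Fintype V] [DecidableEq V] in
/-- At the open pin of a root edge, `slackB = 0` (`σ₃ ≡ 1` on `Q`: `EQb3 = −gap`, `EQ3 = Q`, `PDb = 0`). -/
lemma slackB_one_root (p : E → R) (hends : ends e = s(a₁, a₃)) (a₂ b : V) :
    slackB (Function.update p e 1) ends a₁ a₂ a₃ b = 0 := by
  rw [slackB_eq]
  unfold EQb3 EQ3 PDb Qb
  rw [gap_eq_Q (Function.update p e 1)]
  simp only [CovForm.RootEdge.prob_one_PD_inter p hends a₂, CovForm.RootEdge.prob_one_T_inter p hends a₂,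
    CovForm.RootEdge.prob_one_T'_inter p hends a₂, CovForm.RootEdge.prob_one_PD p hends a₂,
    CovForm.RootEdge.prob_one_T p hends a₂, CovForm.RootEdge.prob_one_T' p hends a₂]
  ring

omit [Fintype V] [DecidableEq V] [LinearOrder R] [IsStrictOrderedRing R] in
/-- At the open pin of a root edge, `Gc = 0` (`D = D_o = 0`). -/
lemma Gc_one_root (p : E → R) (hends : ends e = s(a₁, a₃)) (o a₂ b : V) :
    Gc (Function.update p e 1) ends o a₁ a₂ a₃ b = 0 := by
  unfold Gc DEF
  rw [CovForm.RootEdge.prob_one_PD p hends a₂, Do_one_root p hends o a₂]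
  ring

omit [Fintype V] [DecidableEq V] [LinearOrder R] [IsStrictOrderedRing R] in
/-- **The open pin of (HCOV⁺) at a root edge vanishes.** -/
theorem hcovPlusVal_one_root (p : E → R) (hends : ends e = s(a₁, a₃)) (o a₂ b : V) :
    hcovPlusVal (Function.update p e 1) ends o a₁ a₂ a₃ b = 0 := by
  unfold hcovPlusVal
  rw [Gc_one_root p hends o a₂ b, covU_one_root p hends o a₂]
  ring

omit [Fintype V] [DecidableEq V] [LinearOrder R] [IsStrictOrderedRing R] in
/-- At a root edge `covUm = Qo₁·D₀ − Q₁·Do₀` (the cross term `c` of `proofs/P5-OEDGE.md` §22). -/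
lemma covUm_eq_root (p : E → R) (hends : ends e = s(a₁, a₃)) (o a₂ : V) :
    covUm p ends o a₁ a₂ a₃ e =
      Qo (Function.update p e 1) ends o a₁ a₂ * prob (Function.update p e 0) (PDEvent ends a₁ a₂ a₃) -
        prob (Function.update p e 1) (avoidAll ends a₂ {a₁}) * Do (Function.update p e 0) ends o a₁ a₂ a₃ := by
  unfold covUm
  rw [CovForm.RootEdge.prob_one_PD p hends a₂, Do_one_root p hends o a₂]
  ring

omit [Fintype V] [DecidableEq V] in
/-- **`H3` at a root edge is `Q₁·B2`.** -/
theorem H3_eq_root (p : E → R) (hends : ends e = s(a₁, a₃)) (o a₂ b : V) :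
    H3 p ends o a₁ a₂ a₃ b e =
      prob (Function.update p e 1) (avoidAll ends a₂ {a₁}) * B2 p ends o a₁ a₂ a₃ b e := by
  unfold H3
  rw [Gc_one_root p hends o a₂ b, covU_one_root p hends o a₂, slackB_one_root p hends a₂ b]
  ring

/-- **`0 ≤ H3` at a root edge, unconditionally** (`RootEdge.B2_nonneg_root`). -/
theorem H3_nonneg_root (p : E → R) (hp : IsProbVec p) (hends : ends e = s(a₁, a₃)) (o a₂ b : V) :
    0 ≤ H3 p ends o a₁ a₂ a₃ b e := by
  rw [H3_eq_root p hends o a₂ b]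
  have hp₁ : IsProbVec (Function.update p e 1) := hp.update e zero_le_one le_rfl
  exact mul_nonneg (prob_nonneg hp₁ _) (CovForm.RootEdge.B2_nonneg_root p hp hends o a₂ b)

omit [Fintype V] [DecidableEq V] [LinearOrder R] [IsStrictOrderedRing R] in
/-- **`H1` at a root edge**: `Q₀·B1 + Q₁·Gc₀ + covU₀·slackBm + c·slackB₀`. -/
theorem H1_eq_root (p : E → R) (hends : ends e = s(a₁, a₃)) (o a₂ b : V) :
    H1 p ends o a₁ a₂ a₃ b e =
      prob (Function.update p e 0) (avoidAll ends a₂ {a₁}) * B1 p ends o a₁ a₂ a₃ b e +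
        prob (Function.update p e 1) (avoidAll ends a₂ {a₁}) * Gc (Function.update p e 0) ends o a₁ a₂ a₃ b +
        covU (Function.update p e 0) ends o a₁ a₂ a₃ * slackBm p ends a₁ a₂ a₃ b e +
        (Qo (Function.update p e 1) ends o a₁ a₂ * prob (Function.update p e 0) (PDEvent ends a₁ a₂ a₃) -
          prob (Function.update p e 1) (avoidAll ends a₂ {a₁}) * Do (Function.update p e 0) ends o a₁ a₂ a₃) *
          slackB (Function.update p e 0) ends a₁ a₂ a₃ b := by
  unfold H1
  rw [covUm_eq_root p hends o a₂]

omit [Fintype V] [DecidableEq V] in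
/-- **`H2` at a root edge**: `Q₀·B2 + Q₁·B1 + c·slackBm`. -/
theorem H2_eq_root (p : E → R) (hends : ends e = s(a₁, a₃)) (o a₂ b : V) :
    H2 p ends o a₁ a₂ a₃ b e =
      prob (Function.update p e 0) (avoidAll ends a₂ {a₁}) * B2 p ends o a₁ a₂ a₃ b e +
        prob (Function.update p e 1) (avoidAll ends a₂ {a₁}) * B1 p ends o a₁ a₂ a₃ b e +
        (Qo (Function.update p e 1) ends o a₁ a₂ * prob (Function.update p e 0) (PDEvent ends a₁ a₂ a₃) -
          prob (Function.update p e 1) (avoidAll ends a₂ {a₁}) * Do (Function.update p e 0) ends o a₁ a₂ a₃) *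
          slackBm p ends a₁ a₂ a₃ b e := by
  unfold H2
  rw [covUm_eq_root p hends o a₂, covU_one_root p hends o a₂, slackB_one_root p hends a₂ b]
  ring

omit [Fintype V] [DecidableEq V] [LinearOrder R] [IsStrictOrderedRing R] in
/-- **The quartic factors at a root edge**: `hcovPlusVal p = (1 − t)·[(1 − t)³H₀ + t(1 − t)²H1 + t²(1 − t)H2 + t³H3]`. -/
theorem hcovPlusVal_root_factor (p : E → R) (hends : ends e = s(a₁, a₃)) (o a₂ b : V) :
    hcovPlusVal p ends o a₁ a₂ a₃ b =
      (1 - p e) * ((1 - p e) ^ 3 * hcovPlusVal (Function.update p e 0) ends o a₁ a₂ a₃ b +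
        p e * (1 - p e) ^ 2 * H1 p ends o a₁ a₂ a₃ b e +
        (p e) ^ 2 * (1 - p e) * H2 p ends o a₁ a₂ a₃ b e +
        (p e) ^ 3 * H3 p ends o a₁ a₂ a₃ b e) := by
  rw [hcovPlusVal_pin_quartic p ends o a₁ a₂ a₃ b e, hcovPlusVal_one_root p hends o a₂ b]
  ring

/-- **(HCOV⁺) across a root edge from `0 ≤ H1 ∧ 0 ≤ H2`**: (HCOV⁺) at the closed pin and the two
open coefficients give (HCOV⁺) at `p` (`H3 ≥ 0` and the open pin `= 0` are theorems there). -/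
theorem HCovPlus_of_update_zero_root (p : E → R) (hp : IsProbVec p) (hends : ends e = s(a₁, a₃))
    (o a₂ b : V) (h₀ : HCovPlus (Function.update p e 0) ends o a₁ a₂ a₃ b)
    (hH1 : 0 ≤ H1 p ends o a₁ a₂ a₃ b e) (hH2 : 0 ≤ H2 p ends o a₁ a₂ a₃ b e) :
    HCovPlus p ends o a₁ a₂ a₃ b :=
  HCovPlus_of_update_zero_of_bern p hp ends o a₁ a₂ a₃ b e h₀
    (by rw [HCovPlus_iff, hcovPlusVal_one_root p hends o a₂ b]) hH1 hH2
    (H3_nonneg_root p hp hends o a₂ b)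

end RootEdge

/-! ## The `o`-edge face: the open pin of (HCOV⁺) is `Qo·D·slackB ≥ 0` (the slack the cubic lacks) -/
section OEdge

variable {V : Type*} {E : Type*} [Fintype V] [DecidableEq V] [Fintype E] [DecidableEq E]
  {R : Type*} [Field R] [LinearOrder R] [IsStrictOrderedRing R]

variable {ends : E → Sym2 V} {e : E} {o a₃ : V}

omit [Fintype V] [DecidableEq V] [LinearOrder R] [IsStrictOrderedRing R] in
/-- With the `o`-edge `e = {a₃, o}` open, `a₃ ↔ o` on every configuration of positive weight. -/
lemma conn_a3_o_of_weight (p : E → R) (hends : ends e = s(a₃, o)) {ω : Config E}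
    (hw : weight (Function.update p e 1) ω ≠ 0) : Conn ends ω a₃ o :=
  conn_of_openAdj ⟨e, open_of_weight_ne_zero hw (by simp), hends⟩

omit [Fintype V] [DecidableEq V] [LinearOrder R] [IsStrictOrderedRing R] in
/-- At the open pin of an `o`-edge, `Do = 0` (`o ∈ U` would put `a₃ ∈ U`). -/
lemma Do_one_oedge (p : E → R) (hends : ends e = s(a₃, o)) (a₁ a₂ : V) :
    Do (Function.update p e 1) ends o a₁ a₂ a₃ = 0 := by
  unfold Do
  have key : ∀ x : V, (x = a₁ ∨ x = a₂) →
      prob (Function.update p e 1) (PDEvent ends a₁ a₂ a₃ ∩ connEvent ends x o) = 0 := by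
    intro x hx
    rw [prob_congr_of_weight _ _ (∅ : Set (Config E)) ?_, prob_empty]
    intro ω hw
    simp only [Set.mem_inter_iff, Set.mem_empty_iff_false, iff_false, not_and, PDEvent, Dtilde,
      Set.mem_compl_iff, mem_inU, mem_connEvent]
    intro hPD hxo
    have h3x : Conn ends ω a₃ x := conn_trans (conn_a3_o_of_weight p hends hw) (conn_symm hxo)
    rcases hx with rfl | rfl
    · exact hPD.2 (Or.inl h3x)
    · exact hPD.2 (Or.inr h3x)
  rw [key a₁ (Or.inl rfl), key a₂ (Or.inr rfl)]
  ring

omit [Fintype V] [DecidableEq V] in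
/-- **The open pin of (HCOV⁺) at an `o`-edge is `Qo·D·slackB`** (`Gc = 0` there, `Cov(U_o, U_3) = Var`). -/
theorem hcovPlusVal_one_oedge (p : E → R) (hends : ends e = s(a₃, o)) (a₁ a₂ b : V) :
    hcovPlusVal (Function.update p e 1) ends o a₁ a₂ a₃ b =
      Qo (Function.update p e 1) ends o a₁ a₂ * prob (Function.update p e 1) (PDEvent ends a₁ a₂ a₃) *
        slackB (Function.update p e 1) ends a₁ a₂ a₃ b := by
  unfold hcovPlusVal
  rw [CovForm.CPolarA3.Gc_eq_zero_of_o_joined (fun ω hw => conn_a3_o_of_weight p hends hw), covU_eq,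
    Do_one_oedge p hends a₁ a₂]
  ring

/-- **(HCOV⁺) holds at the open pin of every `o`-edge, unconditionally** — the quartic has open-pin
slack exactly where the cubic has none (`Gc = 0` there). -/
theorem HCovPlus_one_oedge (p : E → R) (hp : IsProbVec p) (hends : ends e = s(a₃, o)) (a₁ a₂ b : V) :
    HCovPlus (Function.update p e 1) ends o a₁ a₂ a₃ b := by
  rw [HCovPlus_iff, hcovPlusVal_one_oedge p hends a₁ a₂ b]
  have hp₁ : IsProbVec (Function.update p e 1) := hp.update e zero_le_one le_rfl
  have hsl := slack_nonneg (Function.update p e 1) hp₁ ends a₁ a₂ a₃ b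
  refine mul_nonneg (mul_nonneg ?_ (prob_nonneg hp₁ _)) ?_
  · exact add_nonneg (prob_nonneg hp₁ _) (prob_nonneg hp₁ _)
  · rw [slackB_eq]; unfold Qb; exact hsl

end OEdge

end HCovPlusQuartic

end Summit.Ventures.PercRepro2
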